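import Summits.AtomisticToContinuum.Crystallization.Theorems.FreeSplittingCertificatesRadiusLadderStar392
import Summits.AtomisticToContinuum.Crystallization.Theorems.FreeSplittingCertificatesRadiusLadderThreshold
import Summits.AtomisticToContinuum.Crystallization.Theorems.FreeSplittingCertificatesRadiusLadderStar953Data

/-!
# `FiniteRangeSplitting` (stmt-AtomisticToContinuum-12559): the non-centrosymmetric star `Star953` —
# `¬ RungAt δ R` for every `δ ≤ 187/200`, `R < 187/200`

Support file for crux r2 of route `FreeSplittingCertificates` (block-2b unit `b2b-freesplit-A`, gen 12).
VALUE = a kernel-checked certificate deciding instances of the crux — NOT summit progress.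

`…RadiusLadderStars` refutes the small-radius rungs up to `δ = 23/25` with the lane's radially relaxed fcc star
`Star959` (an `O_h`-symmetric deep site; the relaxed-fcc family crosses the certified floor `B` at `δ ≈ 0.925`).
The tool `not_rungAt_of_deepSite` needs NO symmetry, and deeper sites exist WITHOUT a centre of symmetry: a
Frank–Kasper / Tammes-type first shell of MORE than twelve neighbours at distances `≈ 1.0–1.08` (all its faces
triangles), the second shell in its pockets, and a relaxed seam to a close-packed exterior.  Such a star gains
`≈ 0.08` in `Σ_{|p| ≤ 2} V` over relaxed fcc and loses most of it again beyond (tetrahedrally close-packed continuations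
are `25–30 %` less dense under a hard minimum distance), netting `≈ 0.01–0.02` — enough to move the refuted range:

* `Star953.sep_conf`, `Star953.centre_half_sum` — the configuration (`953` grid points, data and `decide +kernel`
  certificates in `…RadiusLadderStar953Data*`) is `187/200`-separated and its centre has half pair-sum
  `≤ -1577258750/(2·10⁹) = -0.788629375 < B = -0.786477224`;
* `not_rungAt_187_200` — hence `¬ RungAt δ R` for all `δ ≤ 187/200`, `R < 187/200`; `radius_ge_187_200_of_feasible` — every
  witness `(R, Φ)` of the crux at a hard core `δ ≤ 187/200` reads patterns of radius `R ≥ 187/200`;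
* `not_halfSumFeasible_of_le_187_200` / `not_feasible_halfRule_of_le_187_200` / `halfRule_threshold_bracket_187_200` —
  the deepest-site inequality and the half rule (`…RadiusLadderHalfRuleIff`, `…RadiusLadderHalfRule`) fail at every radius for
  every `δ ≤ 187/200`: the threshold bracket becomes `187/200 < δ_½ ≤ 4/3`.
-/

noncomputable section

namespace Summit.AtomisticToContinuum.Crystallization.Theorems.StrictSplittingRuleBirth

open scoped BigOperators Classical
open Literature.MathematicalPhysics.StatisticalMechanics


/-- A grid-distance bound `(187/200)²·10¹⁴ ≤ isq a b` gives `187/200 ≤ dist`. [folklore] -/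
theorem le_dist_pt_187_200 {a b : ℕ × ℕ × ℕ} (h : 87422500000000 ≤ isq a b) : 187 / 200 ≤ dist (pt a) (pt b) := by
  rw [dist_pt]
  apply Real.le_sqrt_of_sq_le
  rw [le_div_iff₀ (by positivity)]
  have h' : ((87422500000000 : ℕ) : ℝ) ≤ (isq a b : ℝ) := by exact_mod_cast h
  push_cast at h'
  nlinarith [h']

namespace Star953

/-- The configuration `x_k = pts[k] / 10⁷`. [folklore] -/
def conf (k : Fin pts.length) : EuclideanSpace ℝ (Fin 3) := pt pts[k.1]

/-- The centre index. [folklore] -/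
def i0 : Fin pts.length := ⟨0, by simp [pts]⟩

/-- The configuration is `187/200`-separated. [folklore] -/
theorem sep_conf : Sep (187 / 200) conf := by
  intro i j hij
  have hp := List.pairwise_iff_getElem.mp pairwise_sep
  rcases lt_or_gt_of_ne (Fin.val_injective.ne hij) with h | h
  · exact le_dist_pt_187_200 (hp i.1 j.1 i.2 j.2 h)
  · rw [dist_comm]
    exact le_dist_pt_187_200 (hp j.1 i.1 j.2 i.2 h)

/-- The centre half pair-sum is `≤ -1577258750 / (2·10⁹) = -0.7886293750` (`< B`, margin `2.15e-03`).  Per-point bounds by the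
row formula `bOfF`, fed by the centre row of the separation certificate (kept as a local `have`: a separately stated per-point
lemma reads the same in every star file and would be a duplicate declaration). [folklore] -/
theorem centre_half_sum :
    (∑ j ∈ Finset.univ.erase i0, lennardJones (dist (conf i0) (conf j))) / 2 ≤ -(1577258750 : ℝ) / (2 * 10 ^ 9) := by
  have term_le : ∀ a ∈ pts, lennardJones (dist (pt ctr) (pt a)) ≤ -((bOfF (isq ctr a) : ℝ) / 10 ^ 9) := by
    intro a ha
    rcases List.mem_cons.mp ha with rfl | ha'
    · have h1 : isq ctr ctr = 0 := by simp [isq, nd]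
      have h2 : bOfF 0 = 0 := by simp [bOfF]
      rw [dist_self, h1, h2]
      norm_num [lennardJones]
    · have hD := ctr_row a ha'
      have hn : 0 < isq ctr a := lt_of_lt_of_le (by norm_num) hD
      have hrow : 10 ^ 93 ≤ 2 * 10 ^ 51 * isq ctr a ^ 3 :=
        calc (10 : ℕ) ^ 93 ≤ 2 * 10 ^ 51 * 87422500000000 ^ 3 := by norm_num
          _ ≤ 2 * 10 ^ 51 * isq ctr a ^ 3 := Nat.mul_le_mul_left _ (Nat.pow_le_pow_left hD 3)
      rw [dist_pt]
      exact lennardJones_sqrt_le_of_row hn (row_of_bOfF hrow)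
  have h0 : lennardJones (dist (conf i0) (conf i0)) = 0 := by
    rw [dist_self]
    norm_num [lennardJones]
  rw [Finset.sum_erase Finset.univ (f := fun j => lennardJones (dist (conf i0) (conf j))) h0]
  have hle : ∑ j : Fin pts.length, lennardJones (dist (conf i0) (conf j)) ≤
      ∑ j : Fin pts.length, -((bOfF (isq ctr pts[j.1]) : ℝ) / 10 ^ 9) :=
    Finset.sum_le_sum fun j _ => term_le _ (List.getElem_mem j.2)
  have hsum : ∑ j : Fin pts.length, -((bOfF (isq ctr pts[j.1]) : ℝ) / 10 ^ 9) =
      -(((pts.map fun a => bOfF (isq ctr a)).sum : ℕ) : ℝ) / 10 ^ 9 := by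
    rw [← Fin.sum_univ_fun_getElem, Nat.cast_sum, Finset.sum_neg_distrib, ← Finset.sum_div, neg_div]
  rw [hsum, sum_b] at hle
  push_cast at hle
  linarith

end Star953

/-- **Refuted rungs up to `187/200`, as a theorem** (non-centrosymmetric star `Star953`): for every hard core
`δ ≤ 187/200` and every pattern radius `R < 187/200` there is NO feasible pair-splitting rule.  Unconditional
(threshold = tree two-cone bound `B`). -/
theorem not_rungAt_187_200 : ∀ δ R : ℝ, δ ≤ 187 / 200 → R < 187 / 200 → ¬ RungAt δ R := by
  intro δ R hδ hR hrung
  have h : ¬ RungAt (187 / 200) R :=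
    not_rungAt_of_deepSite (by norm_num) hR Star953.conf Star953.sep_conf Star953.i0
      (Star953.centre_half_sum.trans_lt (by unfold twoConeB; norm_num))
  exact h (rungAt_mono_sep hδ hrung)

/-- Read back on crux r2: every witness `(R, Φ)` of `FiniteRangeSplitting` at a hard core `δ ≤ 187/200` has pattern
radius `R ≥ 187/200`. -/
theorem radius_ge_187_200_of_feasible {δ R : ℝ} (hδ : δ ≤ 187 / 200)
    {Φ : EuclideanSpace ℝ (Fin 3) → Finset (EuclideanSpace ℝ (Fin 3)) → ℝ} (hr : IsRule Φ)
    (hf : Feasible δ R Φ) : 187 / 200 ≤ R :=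
  not_lt.mp fun hR => not_rungAt_187_200 δ R hδ hR ⟨Φ, hr, hf⟩

/-- The deepest-site inequality (`…RadiusLadderHalfRuleIff`) fails at every hard core `δ ≤ 187/200`. -/
theorem not_halfSumFeasible_of_le_187_200 {δ : ℝ} (h : δ ≤ 187 / 200) : ¬ HalfSumFeasible δ :=
  not_halfSumFeasible_of_deepSite Star953.conf Star953.sep_conf Star953.i0
    (Star953.centre_half_sum.trans_lt (by unfold twoConeB; norm_num)) δ h

/-- Hence the half rule is infeasible at EVERY radius for every `δ ≤ 187/200`: the threshold bracket of
`…RadiusLadderHalfRule` becomes `187/200 < δ_½ ≤ 4/3`. -/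
theorem not_feasible_halfRule_of_le_187_200 {δ : ℝ} (h : δ ≤ 187 / 200) (R : ℝ) : ¬ Feasible δ R halfRule :=
  fun hf => not_halfSumFeasible_of_le_187_200 h ((feasible_halfRule_iff δ R).1 hf)

/-- **Threshold bracket for the half rule, sharpened**: feasible at every radius for `δ ≥ 4/3`, infeasible at every radius
for `δ ≤ 187/200`. -/
theorem halfRule_threshold_bracket_187_200 :
    (∀ δ : ℝ, 4 / 3 ≤ δ → ∀ R : ℝ, Feasible δ R halfRule) ∧ (∀ δ : ℝ, δ ≤ 187 / 200 → ∀ R : ℝ, ¬ Feasible δ R halfRule) :=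
  ⟨fun _ h R => (feasible_halfRule_iff _ R).2 (halfSumFeasible_of_four_thirds_le h), fun _ h R => not_feasible_halfRule_of_le_187_200 h R⟩

/-- … so `187/200 ≤ δ_½` for the sharp threshold `halfSumThreshold` of `…RadiusLadderThreshold`. -/
theorem le_halfSumThreshold_187_200 : ((187 : ℝ) / 200) ≤ halfSumThreshold :=
  le_halfSumThreshold_of_not (not_halfSumFeasible_of_le_187_200 le_rfl)

/-- The threshold bracket after `Star953`: `δ_½ ∈ [187/200, 4/3]`. -/
theorem halfSumThreshold_mem_Icc_187_200 : halfSumThreshold ∈ Set.Icc ((187 : ℝ) / 200) (4 / 3) :=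
  ⟨le_halfSumThreshold_187_200, halfSumThreshold_mem_Icc.2⟩


end Summit.AtomisticToContinuum.Crystallization.Theorems.StrictSplittingRuleBirth

end
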